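import Summits.CriticalPhenomena.PercolationContinuityZ3.Theorems.PercNearOneGluingNoHeavyLowerTailTwoRowCertificateCex
import HarnessLib

/-!
# `NoHeavyLowerTail` (crux stmt-CriticalPhenomena-4575): the row implication "U2" (`g₀ < 0 ⇒ m₁ ≥ g₁`) of the
# two-row analysis is FALSE, already with `{c,d}` disjoint from the ports — a certified counterexample on six vertices

Prover `prim-hp-3` (hull-port line, gen 2), 2026-08-19; memo `run/shared/lean/prim/prim-hp-3/HULLPORT-REF-gen2.md` §4a,
census `run/shared/lean/ttrl/tps/DDX.md` (ttrl2: 46 / 470 362 dominated disjoint checks fail; smallest exact witness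
re-labelled here).  Setting and rows exactly as in `PercNearOneGluingNoHeavyLowerTailTwoRowCertificateCex.lean`
(`μ_w = prodBernoulli w`, relays `A`, level `j`, observer `u` with ports, best port `x`, relays `c ≠ d`, `i` not ports,
`K = fun e => if u ∈ e then 0 else w e`;  `g₀ = I_w(i) − I_w(x)`,  `m₁ = μ_w(i ↮ {u,c,d}, N_i ≤ j) − μ_w(i ↮ {u,c,d},
1 ≤ |π(u)∪π(c)∪π(d)| ≤ j)`,  `g₁ = I_{w[cd↦1]}(i) − I_{w[cd↦1]}(x)`).  "U2" (prim-hp-3, claimed 0 / 1 229 in the disjoint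
regime) asserted `g₀ < 0 ⇒ g₁ ≤ m₁` under the domination hypotheses.  **It is false** (`not_twoRowU2`): `n = 6`,
`A = {0,…,4}`, `j = 2`, `u = 5` with ports `3` (coin `19/20`) and `x = 4` (coin `1/20`), `c = 1`, `d = 2`, `i = 0`,
`K`-pairs `0–3: 19/20, 2–3: 1/20, 1–4: 19/20, 0–1: 1/20`, `w(1,2) = 0`.  Exactly (2⁷ configurations, the pair `1–2` listed with
weight `0`): `I_K = (181/200, 7601/8000, 381/400, 7259/8000, 381/400)` (so `x = 4` is a best port and dominates `c, d`);
`g₀ = 2765679/3200000 − 2903581/3200000 < 0`, but `g₁ = 2765279/3200000 − 152761/3200000 ≈ 0.816 > m₁ = 14459/160000 −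
6859/3200000 ≈ 0.088`.  ((dd-x) itself holds at this instance; its refutation is the companion file.)

Contents: the `Bool` tests / exact counts / measure-side lemmas of the companion file (imported from the companion file `…TwoRowCertificateCex`, namespace `TwoRowCertCex`), the witness lists `witU2 q` / `witU2K`, the
arithmetic by kernel reduction (`decide +kernel`, standard axioms, no `native_decide`) and the deliverable.  No sorries;
`def`s are checkers / witness data only.
-/

namespace Summit.CriticalPhenomena.PercolationContinuityZ3.Theorems

open MeasureTheory
open Literature.Probability.LatticeModels Literature.Probability.Percolation
open Summit.CriticalPhenomena.PercolationContinuityZ3.Theorems.AdditiveGluing.Negative.Cert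
open Summit.CriticalPhenomena.PercolationContinuityZ3.Theorems.WorstPairExchangeCex (real_eq_wcount)

namespace TwoRowU2Cex

open TwoRowCertCex

/-! ### The witness -/

/-- The witness, `q` = weight of the pair `1–2` (listed first; `q = 0` in the instance): `1–2 q · 0–3 19/20 · 2–3 1/20 ·
1–4 19/20 · 0–1 1/20 · 3–5 19/20 · 4–5 1/20` (`5` = the observer `u`, ports `3, 4`). -/
def witU2 (q : ℚ) : List (Fin 6 × Fin 6 × ℚ) :=
  [(1, 2, q), (0, 3, 19/20), (2, 3, 1/20), (1, 4, 19/20), (0, 1, 1/20), (3, 5, 19/20), (4, 5, 1/20)]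

/-- The witness with the pairs at `u = 5` switched off (the graph `K`). -/
def witU2K : List (Fin 6 × Fin 6 × ℚ) :=
  [(1, 2, 0), (0, 3, 19/20), (2, 3, 1/20), (1, 4, 19/20), (0, 1, 1/20), (3, 5, 0), (4, 5, 0)]

/-- The listed pairs of the witness are distinct. [this file] -/
theorem witU2_nodup (q : ℚ) : (wPairs (witU2 q)).Nodup := by
  have h : wPairs (witU2 q) = wPairs (witU2 0) := rfl
  rw [h]; decide

/-- The witness weights lie in `[0, 1]` when `q` does. [this file] -/
theorem witU2_weights (q : ℚ) (hq : 0 ≤ q ∧ q ≤ 1) : ∀ e ∈ witU2 q, 0 ≤ e.2.2 ∧ e.2.2 ≤ 1 := by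
  intro e he
  simp only [witU2, List.mem_cons, List.not_mem_nil, or_false] at he
  rcases he with rfl | rfl | rfl | rfl | rfl | rfl | rfl
  · exact hq
  all_goals norm_num

/-- The listed pairs of `witU2K` are distinct. [this file] -/
theorem witU2K_nodup : (wPairs witU2K).Nodup := by decide

/-- The `witU2K` weights lie in `[0, 1]`. [this file] -/
theorem witU2K_weights : ∀ e ∈ witU2K, 0 ≤ e.2.2 ∧ e.2.2 ≤ 1 := by
  intro e he
  simp only [witU2K, List.mem_cons, List.not_mem_nil, or_false] at he
  rcases he with rfl | rfl | rfl | rfl | rfl | rfl | rfl <;> norm_num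

/-! ### The arithmetic (exact rational counts over `2⁷` configurations, kernel reduction) -/

/-- The six counts of the unglued / glued witness: `I(0) = 2765679/3200000`, `I(4) = 2903581/3200000`,
`μ(0 ↮ {5,1,2}, N_0 ≤ 2) = 14459/160000`, `μ(0 ↮ {5,1,2}, 1 ≤ |π(5)∪π(1)∪π(2)| ≤ 2) = 6859/3200000`; after gluing `1–2`:
`I(0) = 2765279/3200000`, `I(4) = 152761/3200000`. [this file] -/
theorem values_witU2 : cntLight (witU2 0) 0 = 2765679/3200000 ∧ cntLight (witU2 0) 4 = 2903581/3200000 ∧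
    cntSepLight (witU2 0) 0 = 14459/160000 ∧ cntSepBad (witU2 0) 0 = 6859/3200000 ∧
    cntLight (witU2 1) 0 = 2765279/3200000 ∧ cntLight (witU2 1) 4 = 152761/3200000 := by
  decide +kernel

/-- The `K`-lightnesses: `I_K(1) = 7601/8000`, `I_K(2) = 381/400`, `I_K(3) = 7259/8000` are all `≤ I_K(4) = 381/400`.
[this file] -/
theorem values_witU2U2K : cntLight witU2K 1 ≤ cntLight witU2K 4 ∧ cntLight witU2K 2 ≤ cntLight witU2K 4 ∧
    cntLight witU2K 3 ≤ cntLight witU2K 4 := by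
  decide +kernel

/-! ### Weight bookkeeping -/

/-- Switching off the pairs at `u = 5` in the witness gives `witU2K`. [this file] -/
theorem KU2_eq : (fun e : Sym2 (Fin 6) => if (5 : Fin 6) ∈ e then (0 : unitInterval) else wOfList (witU2 0) e) =
    wOfList witU2K := by
  funext e
  revert e
  refine Sym2.ind fun a b => ?_
  fin_cases a <;> fin_cases b <;>
    simp [wOfList, witU2, witU2K, mkE]

/-- Pairs not listed in the witness have weight `0`. [this file] -/
theorem witU2_off (e : Sym2 (Fin 6)) (he : e ∉ wE (witU2 0)) : wOfList (witU2 0) e = 0 :=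
  wOfList_eq_zero _ e he

/-- The port pair `4–5` has nonzero weight (`1/20`). [this file] -/
theorem witU2_45_ne_zero : wOfList (witU2 0) s(5, 4) ≠ 0 := by
  have h' : wOfList (witU2 0) s((5 : Fin 6), 4) = Set.projIcc (0 : ℝ) 1 zero_le_one ((1/20 : ℚ) : ℝ) := by
    simp [witU2, wOfList, mkE]
  rw [h']
  intro h
  have h2 := congrArg Subtype.val h
  simp [Set.projIcc] at h2
  norm_num at h2

end TwoRowU2Cex

open TwoRowCertCex TwoRowU2Cex
open scoped Classical

/-- **The row implication U2 is FALSE (disjoint regime).**  It is NOT true that for all `n`, relays `A`, levels `j ≥ 1`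
with `j + 3 ≤ |A|`, weights `w`, a non-relay `u` whose positive pairs go to relays only, a port `x ∈ A` of `u`, relays
`c ≠ d` and `i` that are not ports and pairwise distinct from `x` and each other, with `K = (fun e => if u ∈ e then 0 else w e)`:
if every port `p` of `u` has `I_K(p) ≤ I_K(x)`, `I_K(c) ≤ I_K(x)`, `I_K(d) ≤ I_K(x)` and `I_w(i) − I_w(x) < 0`, then
`I_{w[cd↦1]}(i) − I_{w[cd↦1]}(x) ≤ μ_w(i ↮ {u,c,d}, N_i ≤ j) − μ_w(i ↮ {u,c,d}, 1 ≤ |π(u)∪π(c)∪π(d)| ≤ j)`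
(witness: `n = 6`, `A = {0,…,4}`, `j = 2`, `u = 5`, `x = 4`, `c = 1`, `d = 2`, `i = 0`, weights `witU2 0`). [this file] -/
theorem not_twoRowU2 :
    ¬ (∀ (n : ℕ) (A : Finset (Fin n)) (j : ℕ) (w : Sym2 (Fin n) → unitInterval) (u x c d i : Fin n),
      1 ≤ j → j + 3 ≤ A.card → u ∉ A → x ∈ A → c ∈ A → d ∈ A → i ∈ A →
      c ≠ d → x ≠ c → x ≠ d → i ≠ x → i ≠ c → i ≠ d →
      (∀ v : Fin n, v ∉ A → w s(u, v) = 0) →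
      w s(u, x) ≠ 0 → w s(u, i) = 0 → w s(u, c) = 0 → w s(u, d) = 0 →
      (∀ p ∈ A, w s(u, p) ≠ 0 →
        (prodBernoulli (fun e => if u ∈ e then (0 : unitInterval) else w e)).real
            {ω : BondConfig (Fin n) | (A.filter fun z => ω ∈ openConn p z).card ≤ j} ≤
          (prodBernoulli (fun e => if u ∈ e then (0 : unitInterval) else w e)).real
            {ω : BondConfig (Fin n) | (A.filter fun z => ω ∈ openConn x z).card ≤ j}) →
      (prodBernoulli (fun e => if u ∈ e then (0 : unitInterval) else w e)).real
          {ω : BondConfig (Fin n) | (A.filter fun z => ω ∈ openConn c z).card ≤ j} ≤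
        (prodBernoulli (fun e => if u ∈ e then (0 : unitInterval) else w e)).real
          {ω : BondConfig (Fin n) | (A.filter fun z => ω ∈ openConn x z).card ≤ j} →
      (prodBernoulli (fun e => if u ∈ e then (0 : unitInterval) else w e)).real
          {ω : BondConfig (Fin n) | (A.filter fun z => ω ∈ openConn d z).card ≤ j} ≤
        (prodBernoulli (fun e => if u ∈ e then (0 : unitInterval) else w e)).real
          {ω : BondConfig (Fin n) | (A.filter fun z => ω ∈ openConn x z).card ≤ j} →
      (prodBernoulli w).real {ω : BondConfig (Fin n) | (A.filter fun z => ω ∈ openConn i z).card ≤ j} -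
          (prodBernoulli w).real {ω : BondConfig (Fin n) | (A.filter fun z => ω ∈ openConn x z).card ≤ j} < 0 →
      (prodBernoulli (Function.update w s(c, d) 1)).real
            {ω : BondConfig (Fin n) | (A.filter fun z => ω ∈ openConn i z).card ≤ j} -
          (prodBernoulli (Function.update w s(c, d) 1)).real
            {ω : BondConfig (Fin n) | (A.filter fun z => ω ∈ openConn x z).card ≤ j} ≤
        (prodBernoulli w).real {ω : BondConfig (Fin n) |
            (∀ y ∈ ({u, c, d} : Finset (Fin n)), ω ∉ openConn i y) ∧
            (A.filter fun z => ω ∈ openConn i z).card ≤ j} -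
          (prodBernoulli w).real {ω : BondConfig (Fin n) |
            (∀ y ∈ ({u, c, d} : Finset (Fin n)), ω ∉ openConn i y) ∧
            1 ≤ (A.filter fun z => ∃ y ∈ ({u, c, d} : Finset (Fin n)), ω ∈ openConn y z).card ∧
            (A.filter fun z => ∃ y ∈ ({u, c, d} : Finset (Fin n)), ω ∈ openConn y z).card ≤ j}) := by
  intro h
  have hq : (0 : ℚ) ≤ 0 ∧ (0 : ℚ) ≤ 1 := ⟨le_rfl, zero_le_one⟩
  have hq1 : (0 : ℚ) ≤ 1 ∧ (1 : ℚ) ≤ 1 := ⟨zero_le_one, le_rfl⟩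
  obtain ⟨hLi, hLx, hSL, hSB, hLi', hLx'⟩ := values_witU2
  obtain ⟨hK1, hK2, hK3⟩ := values_witU2U2K
  have hoff : ∀ v : Fin 6, v ∉ ({0, 1, 2, 3, 4} : Finset (Fin 6)) → wOfList (witU2 0) s(5, v) = 0 := by
    intro v hv
    have hv5 : v = 5 := by
      fin_cases v <;> simp at hv ⊢
    subst hv5
    exact witU2_off _ (by decide)
  have hKle : ∀ v : Fin 6, v = 1 ∨ v = 2 ∨ v = 3 →
      (prodBernoulli (fun e => if (5 : Fin 6) ∈ e then (0 : unitInterval) else wOfList (witU2 0) e)).real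
          {ω : BondConfig (Fin 6) | (({0, 1, 2, 3, 4} : Finset (Fin 6)).filter fun z => ω ∈ openConn v z).card ≤ 2} ≤
        (prodBernoulli (fun e => if (5 : Fin 6) ∈ e then (0 : unitInterval) else wOfList (witU2 0) e)).real
          {ω : BondConfig (Fin 6) | (({0, 1, 2, 3, 4} : Finset (Fin 6)).filter fun z => ω ∈ openConn 4 z).card ≤ 2} := by
    intro v hv
    rw [KU2_eq, real_light witU2K_nodup witU2K_weights, real_light witU2K_nodup witU2K_weights]
    rcases hv with rfl | rfl | rfl
    · exact_mod_cast hK1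
    · exact_mod_cast hK2
    · exact_mod_cast hK3
  have hports : ∀ p ∈ ({0, 1, 2, 3, 4} : Finset (Fin 6)), wOfList (witU2 0) s(5, p) ≠ 0 →
      (prodBernoulli (fun e => if (5 : Fin 6) ∈ e then (0 : unitInterval) else wOfList (witU2 0) e)).real
          {ω : BondConfig (Fin 6) | (({0, 1, 2, 3, 4} : Finset (Fin 6)).filter fun z => ω ∈ openConn p z).card ≤ 2} ≤
        (prodBernoulli (fun e => if (5 : Fin 6) ∈ e then (0 : unitInterval) else wOfList (witU2 0) e)).real
          {ω : BondConfig (Fin 6) | (({0, 1, 2, 3, 4} : Finset (Fin 6)).filter fun z => ω ∈ openConn 4 z).card ≤ 2} := by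
    intro p hp hne
    simp only [Finset.mem_insert, Finset.mem_singleton] at hp
    rcases hp with rfl | rfl | rfl | rfl | rfl
    · exact absurd (witU2_off _ (by decide)) hne
    · exact absurd (witU2_off _ (by decide)) hne
    · exact absurd (witU2_off _ (by decide)) hne
    · exact hKle 3 (Or.inr (Or.inr rfl))
    · exact le_rfl
  -- row 0: g₀ < 0 at the witness
  have hg0 : (prodBernoulli (wOfList (witU2 0))).real {ω : BondConfig (Fin 6) |
        (({0, 1, 2, 3, 4} : Finset (Fin 6)).filter fun z => ω ∈ openConn (0 : Fin 6) z).card ≤ 2} -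
      (prodBernoulli (wOfList (witU2 0))).real {ω : BondConfig (Fin 6) |
        (({0, 1, 2, 3, 4} : Finset (Fin 6)).filter fun z => ω ∈ openConn (4 : Fin 6) z).card ≤ 2} < 0 := by
    rw [real_light (witU2_nodup _) (witU2_weights _ hq), real_light (witU2_nodup _) (witU2_weights _ hq), hLi, hLx]
    norm_num
  have hc := h 6 {0, 1, 2, 3, 4} 2 (wOfList (witU2 0)) 5 4 1 2 0 (by norm_num) (by decide) (by decide)
    (by decide) (by decide) (by decide) (by decide) (by decide) (by decide) (by decide) (by decide) (by decide)
    (by decide) hoff witU2_45_ne_zero (witU2_off _ (by decide)) (witU2_off _ (by decide)) (witU2_off _ (by decide))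
    hports (hKle 1 (Or.inl rfl)) (hKle 2 (Or.inr (Or.inl rfl))) hg0
  -- gluing `1–2` is `witU2 1`
  have hglu : Function.update (wOfList (witU2 0)) s((1 : Fin 6), 2) 1 = wOfList (witU2 1) :=
    CousinCex.update_wOfList_cons_one (1 : Fin 6) 2 0 _
  rw [hglu, real_light (witU2_nodup _) (witU2_weights _ hq1), real_light (witU2_nodup _) (witU2_weights _ hq1),
    real_sepLight (witU2_nodup _) (witU2_weights _ hq), real_sepBad (witU2_nodup _) (witU2_weights _ hq),
    hLi', hLx', hSL, hSB] at hc
  norm_num at hc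

end Summit.CriticalPhenomena.PercolationContinuityZ3.Theorems
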